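import Literature.IUT.HodgeArakelov.ThetaEnvDataRecordAutSaturatedOfCore
import Literature.IUT.HodgeArakelov.ThetaEnvDataRecordAutSaturatedOfTransport
import Literature.IUT.HodgeArakelov.EtaleThetaDataOfSettingHcycOfHgal
import Literature.IUT.HodgeArakelov.EtaleThetaDataOfSettingCor218i

/-!
# [IUTchII] Prop 3.4 (i) at the GENUINE data — the ROUTE-1 statements of record of node IUTchII:Prop3.4(i) with binder
# (P3) REDUCED TO ITS GALOIS HALF «∀ α ∃ τ, (HGAL)» and binder `hcharY` (F-2633) DISCHARGED from F-0620
# («OFCORE-HGALOIS-TWIN»: the twins of `…_ofCor28i_ofHgalois` for the `_ofGalois` / `_ofCore` / `_ofExtendsTransport` consumers)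

S. Mochizuki, *Inter-universal Teichmüller theory II*, kurims manuscript (Dec. 2020): Prop 3.4 (i) pp. 91–92
[cite: Mochizuki2012, Prop 3.4 (i) p.91]; Cor 1.11 (b) p. 49; Prop 1.4 p. 27.  Claim key DISPUTED (D-0012).  Refereed inputs
BY NAME ([EtTh] = S. Mochizuki, Publ. RIMS **45** (2009)): Cor. 2.18 (i) p. 60 (F-0620, through `RigidData.Cor218_i` at
`C.rigidData`), Thm. 1.6 (iii) p. 24, Prop. 2.4 p. 38, Prop. 1.5 (ii) p. 23, §1 pp. 12–13 (the class-R origin clauses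
`IsEtThOrigin`, `hYcl` = GAP G-w4d021-2, `IsTateOrigin` — never asserted) [cite: MochizukiEtTh2009, Cor 2.18(i) pp.59–60];
[AbsTopIII] Cor. 1.10 pp. 41–44 ((HGAL): every topological automorphism of `Π^tp_{X̲̲}` lies over `Inn(τ)|_{G_K}` — the ONE
remaining FACT-class input of binder (P3), GAP G-w5d169-3, ruling C-R25).

abc-iut cell, layer L6, WAVE-4 seat abc-iut-w4-d041 (gen 8), row «OFCORE-HGALOIS-TWIN» (named open by abc-iut-w5-d169 g5,
2026-08-26T14:33:28Z).  PROOF-ONLY (no definition, no `Prop`-valued fact, nothing of another seat restated): abc-iut-w5-d169's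
file 5 `ThetaEnvDataRecordAutSaturatedOfHgalois.lean` (p451049) did this for the ROUTE-2 consumer `_saturated_ofCor28i`;
here the three other statement-of-record consumers get the same treatment, so that EVERY variant of the node statement
carries (P3) := (HGAL) alone and no free `PiYddCharacteristic` binder:
* the hypothesis `hgal = (HGAL) ∧ (HCYC)` of `EtaleLevels.prop34i_multiradiallyDefined_saturated_of{Galois,Core,ExtendsTransport}`
  (p437226 abc-iut-w5-d169 / p439139 abc-iut-w6-d002 / p438115 this seat) is SUPPLIED by
  `EtaleThetaDataOfSetting.hgal_of_hgalois` (p450689: (HCYC) ⟸ (HGAL) modulo `IsEtThOrigin`, `hYcl`, `IsTateOrigin`, `hq`)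
  from `hHGAL : ∀ α ∃ τ, aug(α x) = τ aug(x) τ⁻¹`;
* the hypothesis `hcharY : PiYddCharacteristic C` ([IUTchII] Prop 1.4's «corresponding to the tempered covering `Ÿ`»,
  FACT row F-2633, class «inside the cone: prove») is SUPPLIED by abc-iut-w4-d013's
  `EtaleThetaDataOfSetting.piYddCharacteristic_of_cor218_i` from F-0620 at `C.rigidData` (the `h218i` binder the statements
  already carry) — exactly as abc-iut-w6-d051's `…_ofCor28iIntrinsic` (p447525) does.
Theorems (each a one-line application of the landed statement of record):
* `prop34i_multiradiallyDefined_saturated_ofGalois_ofHgalois` / `exists_coeff_…` — generic (P4) `hroot`; residual BY NAME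
  {F-0620, `hq`, `hroot`, `hO'`, `hYcl`, `hT`, `hHGAL`} (+ `hΔc` for the coefficient-free form) + standing record/tower inputs;
* `prop34i_multiradiallyDefined_saturated_ofCore_ofHgalois` / `exists_coeff_…` — ROUTE 1, core identity: residual BY NAME
  {F-0620, `hq`, `hO'`, `hYcl`, `hT`, `h15ii` ([EtTh] Prop 1.5 (ii)), `hsign`, `hE` = (E1′)+(E3)+(UNIT)+(LABEL), `hHGAL`};
* `prop34i_multiradiallyDefined_saturated_ofExtendsTransport_ofHgalois` / `exists_coeff_…` — ROUTE 1, [EtTh] §1 transport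
  shape: residual BY NAME {F-0620, `hq`, `hO'`, `hYcl`, `hT`, `hE` = extension + companion + «transport(η̈^Θ) = conj_τ(η̈^Θ)»,
  `hHGAL`}.
Nothing here asserts anything of [IUTchII], [EtTh] or [AbsTopIII]; (HGAL) and the class-R clauses stay hypotheses BY NAME;
no side taken on [IUTchIII] Cor. 3.12; typed ≠ proved for the binders.
-/

noncomputable section

open Topology

namespace Literature.IUT.HodgeArakelov

open Literature.AnabelianGeometry.EtaleTheta Literature.AnabelianGeometry.SemiGraphs
open CohomologySystemOfContH1 EtaleThetaDataOfSetting TemperedThetaMonoids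
open scoped Literature.AnabelianGeometry.EtaleTheta

namespace EtaleLevels

variable {p : ℕ} [Fact p.Prime] {D : Literature.AnabelianGeometry.EtaleTheta.ThetaSetting p}
  {E : D.EtaleThetaData} {l : ℕ} (C : E.DoubleUnderline l) (hC : D.Compat) (hS : D.Sec2Hyps)
  (hl : l.Prime) (hp2 : p ≠ 2) (hpl : p ≠ l) (hζ : ∃ ζ : D.K, IsPrimitiveRoot ζ (4 * l))
  (mods : ∀ M : ℕ+, D.CyclotomeMod l M)
  (f : contCocycles D.toTheta D.DeltaTheta C.GtpYdduu) (hf : f ∈ C.rootCocycles hC)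
  (hmods : ∀ (M M' : ℕ+) (h : (M : ℕ) ∣ (M' : ℕ)) (x : D.lDeltaTheta l),
    MuN.red p M M' h ((mods M').red x) = (mods M).red x)
  (h15 : Literature.AnabelianGeometry.EtaleTheta.ThetaSetting.Prop15iii E hC) (L : C.CuspLabels)
  (hZ : ∀ M : ℕ+, Nonempty (ModelCyclotomes.lDeltaQuot (C.rigidData (mods M) hC hS h15 L) ≃*
    Literature.IUT.HodgeTheaters.ZHat))
  (hlim : Function.Bijective (rigidLimHom C hC hS hl hp2 hpl hζ mods f hf hmods h15 L hZ))
  [(EtaleThetaDataOfSetting.PiYdd C).Normal]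
  (hq : IsQuotientMap D.toTheta) {N : ℕ+} (μ : D.CyclotomeMod l N)
  (R : RigidData.{0} N l) (hR : R = C.rigidData μ hC hS h15 L) (h218i : R.Cor218_i)
  (ι₀ : (Pi C) ≃ₜ* (Pi C))
  {Es : Set ℕ+} (τw : D.CyclotomeTower l Es)
  (O : Submonoid (PadicAlgCl p)ˣ)
  (hO : ∀ (σ : GQp p) (u : (PadicAlgCl p)ˣ), u ∈ O → Units.map (σ : PadicAlgCl p →* PadicAlgCl p) u ∈ O)
  (hO' : D.IsEtThOrigin)
  -- the class-R §1 origin clauses under which (HCYC) ⟸ (HGAL) (`EtaleThetaDataOfSetting.hcyc_of_hgal`)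
  (hYcl : (D.DtpY.map D.toHat.toMonoidHom).topologicalClosure ≤
    D.DtpY.map D.toHat.toMonoidHom ⊔ (⁅⁅D.DeltaHat, D.DeltaHat⁆, D.DeltaHat⁆).topologicalClosure)
  (hT : D.IsTateOrigin)
  -- (P3) = (HGAL) ALONE: every topological automorphism of `Π^tp_{X̲̲}` lies over `Inn(τ)|_{G_K}` ([AbsTopIII] Cor 1.10)
  (hHGAL : ∀ α : (Pi C) ≃ₜ* (Pi C), ∃ τ : GQp p, ∀ x : Pi C, aug C (α x) = τ * aug C x * τ⁻¹)

/-! ### 1. Generic `hroot` (statement of record `_saturated_ofGalois`, p437226) -/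

section Galois

variable
  (hroot : ∀ α : (Pi C) ≃ₜ* (Pi C), ∃ τ : Pi C, ∃ ε : (coh C).H1 ⊤, l • ε = 0 ∧
    autActTopOfCor218i C hq μ hC hS h15 L R hR h218i α (rootTop C) =
      h1TopConjEquiv (phi C) (D.lDeltaTheta l) (PiYdd C) τ (rootTop C) + ε)

/-- **[IUTchII] Prop 3.4 (i) — MULTIRADIALITY OF SPLIT THETA MONOIDS AT THE GENUINE FUNCTOR, generic (P4), (P3) = (HGAL)
alone**: the statement of record `prop34i_multiradiallyDefined_saturated_ofGalois` with `hgal` := `hgal_of_hgalois … hHGAL`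
(cyclotomic half PROVED) and `hcharY` := `piYddCharacteristic_of_cor218_i` (F-2633 from F-0620).
Residual BY NAME {F-0620, `hq`, `hroot`, `hO'`, `hYcl`, `hT`, `hHGAL`}. [cite: Mochizuki2012, Prop 3.4 (i) p.92] -/
theorem prop34i_multiradiallyDefined_saturated_ofGalois_ofHgalois
    (c : CyclotomeCoefficients (phi C) (D.lDeltaTheta l) (PadicAlgCl p)ˣ)
    (hlev : ∀ (ζ : cyclotome (PadicAlgCl p)ˣ) (M : ℕ+),
      (((τw.modAll M).red (c.hom ζ) : MuN p M) : (PadicAlgCl p)ˣ) = (ζ : ℕ+ → (PadicAlgCl p)ˣ) M)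
    {η : (C.thetaEnvData μ hC hS).PiYdd → MuN p N} (hη : η ∈ (C.thetaEnvData μ hC hS).thetaCocycles)
    (Γ : Type) [Group Γ] :
    ((ex18iii (ThetaSetting.ofDoubleUnderline C μ hC hS hl hp2 hpl hζ hη) Γ).toDagger
      (TemperedThetaMonoids.prop34iRadialFunctor
        (thetaEnvTransportS C hC hS hl hp2 hpl hζ mods f hf hmods h15 L hZ
          (piYddCharacteristic_of_cor218_i C μ hC hS h15 L R hR h218i) hlim hq μ R hR h218i
          (h1LimKummerOn (phi C) (D.lDeltaTheta l) (PiYdd C) c (isOpen_stabilizer_units C)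
            (finiteIndex_stabilizer_units C) O) ι₀
          (map_mrange_h1LimKummerOn_eq_of_galois C hq μ τw c hlev O hO hC hS h15 L R hR h218i hO'
            (hgal_of_hgalois C hO' hYcl hT hS hq μ hC h15 L R hR h218i τw hHGAL))
          (image_toLim_theta_thetaEnvData_of_rootHyp C hC hS hl hp2 hpl hζ mods f hf hmods h15 L hZ
            (piYddCharacteristic_of_cor218_i C μ hC hS h15 L R hR h218i) hlim hq μ R hR h218i hroot)
          (image_thetaInfty_thetaEnvData_of_rootHyp C hC hS hl hp2 hpl hζ mods f hf hmods h15 L hZ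
            (piYddCharacteristic_of_cor218_i C μ hC hS h15 L R hR h218i) hlim hq μ R hR h218i hroot) hη)
        Γ)).IsMultiradiallyDefined :=
  prop34i_multiradiallyDefined_saturated_ofGalois C hC hS hl hp2 hpl hζ mods f hf hmods h15 L hZ
    (piYddCharacteristic_of_cor218_i C μ hC hS h15 L R hR h218i) hlim hq μ R hR h218i hroot ι₀ τw O hO hO'
    (hgal_of_hgalois C hO' hYcl hT hS hq μ hC h15 L R hR h218i τw hHGAL) c hlev hη Γ

/-- **The same with the coefficient datum DISCHARGED** (abc-iut-w4-d007's `exists_cyclotomeCoefficients_of_cyclotomeTower`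
under `hO'` and compactness of `Δ_Θ`): residual BY NAME {F-0620, `hq`, `hroot`, `hO'`, `hYcl`, `hT`, `hHGAL`, `hΔc`} plus the
standing record/tower inputs. [cite: Mochizuki2012, Prop 3.4 (i) p.92] -/
theorem exists_coeff_prop34i_multiradiallyDefined_saturated_ofGalois_ofHgalois
    (hΔc : IsCompact (D.DeltaTheta : Set D.GtpTheta))
    {η : (C.thetaEnvData μ hC hS).PiYdd → MuN p N} (hη : η ∈ (C.thetaEnvData μ hC hS).thetaCocycles)
    (Γ : Type) [Group Γ] :
    ∃ (c : CyclotomeCoefficients (phi C) (D.lDeltaTheta l) (PadicAlgCl p)ˣ)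
      (hlev : ∀ (ζ : cyclotome (PadicAlgCl p)ˣ) (M : ℕ+),
        (((τw.modAll M).red (c.hom ζ) : MuN p M) : (PadicAlgCl p)ˣ) = (ζ : ℕ+ → (PadicAlgCl p)ˣ) M),
      Function.Bijective c.hom ∧
      ((ex18iii (ThetaSetting.ofDoubleUnderline C μ hC hS hl hp2 hpl hζ hη) Γ).toDagger
        (TemperedThetaMonoids.prop34iRadialFunctor
          (thetaEnvTransportS C hC hS hl hp2 hpl hζ mods f hf hmods h15 L hZ
            (piYddCharacteristic_of_cor218_i C μ hC hS h15 L R hR h218i) hlim hq μ R hR h218i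
            (h1LimKummerOn (phi C) (D.lDeltaTheta l) (PiYdd C) c (isOpen_stabilizer_units C)
              (finiteIndex_stabilizer_units C) O) ι₀
            (map_mrange_h1LimKummerOn_eq_of_galois C hq μ τw c hlev O hO hC hS h15 L R hR h218i hO'
              (hgal_of_hgalois C hO' hYcl hT hS hq μ hC h15 L R hR h218i τw hHGAL))
            (image_toLim_theta_thetaEnvData_of_rootHyp C hC hS hl hp2 hpl hζ mods f hf hmods h15 L hZ
              (piYddCharacteristic_of_cor218_i C μ hC hS h15 L R hR h218i) hlim hq μ R hR h218i hroot)
            (image_thetaInfty_thetaEnvData_of_rootHyp C hC hS hl hp2 hpl hζ mods f hf hmods h15 L hZ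
              (piYddCharacteristic_of_cor218_i C μ hC hS h15 L R hR h218i) hlim hq μ R hR h218i hroot) hη)
          Γ)).IsMultiradiallyDefined :=
  exists_coeff_prop34i_multiradiallyDefined_saturated_ofGalois C hC hS hl hp2 hpl hζ mods f hf hmods h15 L hZ
    (piYddCharacteristic_of_cor218_i C μ hC hS h15 L R hR h218i) hlim hq μ R hR h218i hroot ι₀ τw O hO hO'
    (hgal_of_hgalois C hO' hYcl hT hS hq μ hC h15 L R hR h218i τw hHGAL) hΔc hη Γ

end Galois

/-! ### 2. ROUTE 1, core identity (statement of record `_saturated_ofCore`, p439139) -/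

section Core

variable
  (h15ii : ThetaSetting.Prop15ii E.toKummerData hC) {m : D.H1 D.GtpYdd} (hm : m ∈ E.kumUnitsYdd)
  (hsign : ∃ ι₂ : Pi C, haveI := hC.GtpYdd_normal
    ContH1.conj D.toTheta D.DeltaTheta (ι₂ : D.PiTemp) E.etaDd = m * E.etaDd)
  (hE : ∀ α : (Pi C) ≃ₜ* (Pi C), ∃ (γ : D.PiTemp ≃ₜ* D.PiTemp)
    (_ : ∀ x : Pi C, ((α x : Pi C) : D.PiTemp) = γ (x : D.PiTemp)) (h : ThetaSetting.Thm16i γ)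
    (hΔ : D.DeltaTemp.map γ.toMulEquiv.toMonoidHom = D.DeltaTemp) (k : D.H1 D.GtpYdd) (σ : D.PiTemp),
    haveI := hC.GtpYdd_normal
    ThetaSetting.transport (D.thetaCompanionOfAut γ hΔ hq) h E.etaDd =
        k * ContH1.conj D.toTheta D.DeltaTheta σ E.etaDd ∧
      (k = 1 ∨ k = m) ∧ ∃ (τ₀ : Pi C) (y : D.PiTemp), y ∈ D.GtpYdd ∧ σ = (τ₀ : D.PiTemp) * y)

/-- **[IUTchII] Prop 3.4 (i) at the genuine functor along ROUTE 1 (core identity), (P3) = (HGAL) alone**: the statement of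
record `prop34i_multiradiallyDefined_saturated_ofCore` with `hgal` := `hgal_of_hgalois … hHGAL` and `hcharY` :=
`piYddCharacteristic_of_cor218_i`.  Residual BY NAME {F-0620, `hq`, `hO'`, `hYcl`, `hT`, `h15ii`, `hsign`, `hE`, `hHGAL`}.
[cite: Mochizuki2012, Prop 3.4 (i) p.92] -/
theorem prop34i_multiradiallyDefined_saturated_ofCore_ofHgalois
    (c : CyclotomeCoefficients (phi C) (D.lDeltaTheta l) (PadicAlgCl p)ˣ)
    (hlev : ∀ (ζ : cyclotome (PadicAlgCl p)ˣ) (M : ℕ+),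
      (((τw.modAll M).red (c.hom ζ) : MuN p M) : (PadicAlgCl p)ˣ) = (ζ : ℕ+ → (PadicAlgCl p)ˣ) M)
    {η : (C.thetaEnvData μ hC hS).PiYdd → MuN p N} (hη : η ∈ (C.thetaEnvData μ hC hS).thetaCocycles)
    (Γ : Type) [Group Γ] :
    ((ex18iii (ThetaSetting.ofDoubleUnderline C μ hC hS hl hp2 hpl hζ hη) Γ).toDagger
      (TemperedThetaMonoids.prop34iRadialFunctor
        (thetaEnvTransportS C hC hS hl hp2 hpl hζ mods f hf hmods h15 L hZ
          (piYddCharacteristic_of_cor218_i C μ hC hS h15 L R hR h218i) hlim hq μ R hR h218i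
          (h1LimKummerOn (phi C) (D.lDeltaTheta l) (PiYdd C) c (isOpen_stabilizer_units C)
            (finiteIndex_stabilizer_units C) O) ι₀
          (map_mrange_h1LimKummerOn_eq_of_galois C hq μ τw c hlev O hO hC hS h15 L R hR h218i hO'
            (hgal_of_hgalois C hO' hYcl hT hS hq μ hC h15 L R hR h218i τw hHGAL))
          (image_toLim_theta_thetaEnvData_of_rootHyp C hC hS hl hp2 hpl hζ mods f hf hmods h15 L hZ
            (piYddCharacteristic_of_cor218_i C μ hC hS h15 L R hR h218i) hlim hq μ R hR h218i
            (rootHyp_of_forall_extends_core_deltaStable C hq μ hC hS h15 L R hR h218i h15ii hm hsign hE))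
          (image_thetaInfty_thetaEnvData_of_rootHyp C hC hS hl hp2 hpl hζ mods f hf hmods h15 L hZ
            (piYddCharacteristic_of_cor218_i C μ hC hS h15 L R hR h218i) hlim hq μ R hR h218i
            (rootHyp_of_forall_extends_core_deltaStable C hq μ hC hS h15 L R hR h218i h15ii hm hsign hE)) hη)
        Γ)).IsMultiradiallyDefined :=
  prop34i_multiradiallyDefined_saturated_ofCore C hC hS hl hp2 hpl hζ mods f hf hmods h15 L hZ
    (piYddCharacteristic_of_cor218_i C μ hC hS h15 L R hR h218i) hlim hq μ R hR h218i h15ii hm hsign hE ι₀ τw O hO hO'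
    (hgal_of_hgalois C hO' hYcl hT hS hq μ hC h15 L R hR h218i τw hHGAL) c hlev hη Γ

/-- **The same with the coefficient datum DISCHARGED**: residual BY NAME {F-0620, `hq`, `hO'`, `hYcl`, `hT`, `h15ii`, `hsign`,
`hE`, `hHGAL`, `hΔc`} plus the standing record/tower inputs. [cite: Mochizuki2012, Prop 3.4 (i) p.92] -/
theorem exists_coeff_prop34i_multiradiallyDefined_saturated_ofCore_ofHgalois
    (hΔc : IsCompact (D.DeltaTheta : Set D.GtpTheta))
    {η : (C.thetaEnvData μ hC hS).PiYdd → MuN p N} (hη : η ∈ (C.thetaEnvData μ hC hS).thetaCocycles)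
    (Γ : Type) [Group Γ] :
    ∃ (c : CyclotomeCoefficients (phi C) (D.lDeltaTheta l) (PadicAlgCl p)ˣ)
      (hlev : ∀ (ζ : cyclotome (PadicAlgCl p)ˣ) (M : ℕ+),
        (((τw.modAll M).red (c.hom ζ) : MuN p M) : (PadicAlgCl p)ˣ) = (ζ : ℕ+ → (PadicAlgCl p)ˣ) M),
      Function.Bijective c.hom ∧
      ((ex18iii (ThetaSetting.ofDoubleUnderline C μ hC hS hl hp2 hpl hζ hη) Γ).toDagger
        (TemperedThetaMonoids.prop34iRadialFunctor
          (thetaEnvTransportS C hC hS hl hp2 hpl hζ mods f hf hmods h15 L hZ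
            (piYddCharacteristic_of_cor218_i C μ hC hS h15 L R hR h218i) hlim hq μ R hR h218i
            (h1LimKummerOn (phi C) (D.lDeltaTheta l) (PiYdd C) c (isOpen_stabilizer_units C)
              (finiteIndex_stabilizer_units C) O) ι₀
            (map_mrange_h1LimKummerOn_eq_of_galois C hq μ τw c hlev O hO hC hS h15 L R hR h218i hO'
              (hgal_of_hgalois C hO' hYcl hT hS hq μ hC h15 L R hR h218i τw hHGAL))
            (image_toLim_theta_thetaEnvData_of_rootHyp C hC hS hl hp2 hpl hζ mods f hf hmods h15 L hZ
              (piYddCharacteristic_of_cor218_i C μ hC hS h15 L R hR h218i) hlim hq μ R hR h218i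
              (rootHyp_of_forall_extends_core_deltaStable C hq μ hC hS h15 L R hR h218i h15ii hm hsign hE))
            (image_thetaInfty_thetaEnvData_of_rootHyp C hC hS hl hp2 hpl hζ mods f hf hmods h15 L hZ
              (piYddCharacteristic_of_cor218_i C μ hC hS h15 L R hR h218i) hlim hq μ R hR h218i
              (rootHyp_of_forall_extends_core_deltaStable C hq μ hC hS h15 L R hR h218i h15ii hm hsign hE)) hη)
          Γ)).IsMultiradiallyDefined :=
  exists_coeff_prop34i_multiradiallyDefined_saturated_ofCore C hC hS hl hp2 hpl hζ mods f hf hmods h15 L hZ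
    (piYddCharacteristic_of_cor218_i C μ hC hS h15 L R hR h218i) hlim hq μ R hR h218i h15ii hm hsign hE ι₀ τw O hO hO'
    (hgal_of_hgalois C hO' hYcl hT hS hq μ hC h15 L R hR h218i τw hHGAL) hΔc hη Γ

end Core

/-! ### 3. ROUTE 1, [EtTh] §1 transport shape (statement of record `_saturated_ofExtendsTransport`, p438115) -/

section Transport

variable [D.GtpYdd.Normal]
  (hE : ∀ α : (Pi C) ≃ₜ* (Pi C), ∃ (γ : D.PiTemp ≃ₜ* D.PiTemp)
    (_ : ∀ x : Pi C, ((α x : Pi C) : D.PiTemp) = γ (x : D.PiTemp)) (h : ThetaSetting.Thm16i γ)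
    (c : ThetaSetting.ThetaCompanion γ) (τ : Pi C),
    ContH1.comap D.toTheta D.DeltaTheta C.Huu.subtype continuous_subtype_val
        (map_subtype_piYdd_inf_le_GtpYdd C ⊤) (ThetaSetting.transport c h E.etaDd) =
      ContH1.comap D.toTheta D.DeltaTheta C.Huu.subtype continuous_subtype_val
        (map_subtype_piYdd_inf_le_GtpYdd C ⊤) (ContH1.conj D.toTheta D.DeltaTheta (τ : D.PiTemp) E.etaDd))

/-- **[IUTchII] Prop 3.4 (i) at the genuine functor along ROUTE 1 ([EtTh] §1 transport shape), (P3) = (HGAL) alone**: the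
statement of record `prop34i_multiradiallyDefined_saturated_ofExtendsTransport` (this seat, gen 7) with `hgal` :=
`hgal_of_hgalois … hHGAL` and `hcharY` := `piYddCharacteristic_of_cor218_i`.  Residual BY NAME {F-0620, `hq`, `hO'`, `hYcl`,
`hT`, `hE`, `hHGAL`}. [cite: Mochizuki2012, Prop 3.4 (i) p.92] -/
theorem prop34i_multiradiallyDefined_saturated_ofExtendsTransport_ofHgalois
    (c : CyclotomeCoefficients (phi C) (D.lDeltaTheta l) (PadicAlgCl p)ˣ)
    (hlev : ∀ (ζ : cyclotome (PadicAlgCl p)ˣ) (M : ℕ+),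
      (((τw.modAll M).red (c.hom ζ) : MuN p M) : (PadicAlgCl p)ˣ) = (ζ : ℕ+ → (PadicAlgCl p)ˣ) M)
    {η : (C.thetaEnvData μ hC hS).PiYdd → MuN p N} (hη : η ∈ (C.thetaEnvData μ hC hS).thetaCocycles)
    (Γ : Type) [Group Γ] :
    ((ex18iii (ThetaSetting.ofDoubleUnderline C μ hC hS hl hp2 hpl hζ hη) Γ).toDagger
      (TemperedThetaMonoids.prop34iRadialFunctor
        (thetaEnvTransportS C hC hS hl hp2 hpl hζ mods f hf hmods h15 L hZ
          (piYddCharacteristic_of_cor218_i C μ hC hS h15 L R hR h218i) hlim hq μ R hR h218i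
          (h1LimKummerOn (phi C) (D.lDeltaTheta l) (PiYdd C) c (isOpen_stabilizer_units C)
            (finiteIndex_stabilizer_units C) O) ι₀
          (map_mrange_h1LimKummerOn_eq_of_galois C hq μ τw c hlev O hO hC hS h15 L R hR h218i hO'
            (hgal_of_hgalois C hO' hYcl hT hS hq μ hC h15 L R hR h218i τw hHGAL))
          (image_toLim_theta_thetaEnvData_of_rootHyp C hC hS hl hp2 hpl hζ mods f hf hmods h15 L hZ
            (piYddCharacteristic_of_cor218_i C μ hC hS h15 L R hR h218i) hlim hq μ R hR h218i
            (rootHyp_of_forall_extends_transport C hq μ hC hS h15 L R hR h218i hE))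
          (image_thetaInfty_thetaEnvData_of_rootHyp C hC hS hl hp2 hpl hζ mods f hf hmods h15 L hZ
            (piYddCharacteristic_of_cor218_i C μ hC hS h15 L R hR h218i) hlim hq μ R hR h218i
            (rootHyp_of_forall_extends_transport C hq μ hC hS h15 L R hR h218i hE)) hη)
        Γ)).IsMultiradiallyDefined :=
  prop34i_multiradiallyDefined_saturated_ofExtendsTransport C hC hS hl hp2 hpl hζ mods f hf hmods h15 L hZ
    (piYddCharacteristic_of_cor218_i C μ hC hS h15 L R hR h218i) hlim hq μ R hR h218i hE ι₀ τw O hO hO'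
    (hgal_of_hgalois C hO' hYcl hT hS hq μ hC h15 L R hR h218i τw hHGAL) c hlev hη Γ

/-- **The same with the coefficient datum DISCHARGED**: residual BY NAME {F-0620, `hq`, `hO'`, `hYcl`, `hT`, `hE`, `hHGAL`,
`hΔc`} plus the standing record/tower inputs. [cite: Mochizuki2012, Prop 3.4 (i) p.92] -/
theorem exists_coeff_prop34i_multiradiallyDefined_saturated_ofExtendsTransport_ofHgalois
    (hΔc : IsCompact (D.DeltaTheta : Set D.GtpTheta))
    {η : (C.thetaEnvData μ hC hS).PiYdd → MuN p N} (hη : η ∈ (C.thetaEnvData μ hC hS).thetaCocycles)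
    (Γ : Type) [Group Γ] :
    ∃ (c : CyclotomeCoefficients (phi C) (D.lDeltaTheta l) (PadicAlgCl p)ˣ)
      (hlev : ∀ (ζ : cyclotome (PadicAlgCl p)ˣ) (M : ℕ+),
        (((τw.modAll M).red (c.hom ζ) : MuN p M) : (PadicAlgCl p)ˣ) = (ζ : ℕ+ → (PadicAlgCl p)ˣ) M),
      Function.Bijective c.hom ∧
      ((ex18iii (ThetaSetting.ofDoubleUnderline C μ hC hS hl hp2 hpl hζ hη) Γ).toDagger
        (TemperedThetaMonoids.prop34iRadialFunctor
          (thetaEnvTransportS C hC hS hl hp2 hpl hζ mods f hf hmods h15 L hZ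
            (piYddCharacteristic_of_cor218_i C μ hC hS h15 L R hR h218i) hlim hq μ R hR h218i
            (h1LimKummerOn (phi C) (D.lDeltaTheta l) (PiYdd C) c (isOpen_stabilizer_units C)
              (finiteIndex_stabilizer_units C) O) ι₀
            (map_mrange_h1LimKummerOn_eq_of_galois C hq μ τw c hlev O hO hC hS h15 L R hR h218i hO'
              (hgal_of_hgalois C hO' hYcl hT hS hq μ hC h15 L R hR h218i τw hHGAL))
            (image_toLim_theta_thetaEnvData_of_rootHyp C hC hS hl hp2 hpl hζ mods f hf hmods h15 L hZ
              (piYddCharacteristic_of_cor218_i C μ hC hS h15 L R hR h218i) hlim hq μ R hR h218i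
              (rootHyp_of_forall_extends_transport C hq μ hC hS h15 L R hR h218i hE))
            (image_thetaInfty_thetaEnvData_of_rootHyp C hC hS hl hp2 hpl hζ mods f hf hmods h15 L hZ
              (piYddCharacteristic_of_cor218_i C μ hC hS h15 L R hR h218i) hlim hq μ R hR h218i
              (rootHyp_of_forall_extends_transport C hq μ hC hS h15 L R hR h218i hE)) hη)
          Γ)).IsMultiradiallyDefined :=
  exists_coeff_prop34i_multiradiallyDefined_saturated_ofExtendsTransport C hC hS hl hp2 hpl hζ mods f hf hmods h15 L hZ
    (piYddCharacteristic_of_cor218_i C μ hC hS h15 L R hR h218i) hlim hq μ R hR h218i hE ι₀ τw O hO hO'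
    (hgal_of_hgalois C hO' hYcl hT hS hq μ hC h15 L R hR h218i τw hHGAL) hΔc hη Γ

end Transport

end EtaleLevels

end Literature.IUT.HodgeArakelov

end
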